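import Literature.Geometry.ComplexHyperbolic.UnitBallFrameTransport          -- ★ W3: the frame `rotMat W |W|`, pencil pieces as conjugates
import Literature.Geometry.ComplexHyperbolic.UnitBallPolarCoordinates        -- ★ `nsq_real_smul`
import Literature.Analysis.Calculus.NestedFDerivCompContinuousLinear          -- ★ `Dʲ(Θ∘A)(x)[v…] = DʲΘ(Ax)[Av…]`
import HarnessLib

/-!
# The value at the centre of `U(2,1)`, (A4-iii): the ψ-integrand of a `K`-invariant test function is RADIAL — transport of p05's wall-curve jets to the representative ray,
# and the scalar `ζ` stripped (Rogawski 1990 §8.4 pp. 126–127; Goldman 1999 §3.1.1)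

Topic `Geometry/ComplexHyperbolic`; namespace `Literature.Geometry.ComplexHyperbolic.BallModel`.  THEOREMS ONLY (no `def`, no instance, no notation, no axiom, no named fact,
no `sorry`).  Cell `pub/hodgecm-mathlib`, ENGINE T1 (crux H413 = `stmt-HodgeConjecture-24833`); ROAD A, (A4-iii) «THE VALUE», work package **W6-ψ** (design
`F0/P3a/F0P3a-p06/g12/DESIGN-W6-Assembly.F0P3a-p06g12.md` §1 in its `K`-invariant form, bus 2026-09-01T11:5xZ); author F0P3a-p06 (g12), 2026-09-01.
`open scoped Matrix.Norms.Operator` as ★ p05's `UnitBallKCentralWallCurveChain` (same `fderiv` instances).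

WHAT THIS IS.  ★ p05 `iteratedDerivWithin_two_wallCurve_sheetIntegral_zero_eq` writes `𝓘_ψ″(0⁺)` as `∫_{ℂ²} D²Θ(h₀(W))[X₁(W), X₁(W)] + DΘ(h₀(W))[X₂(W)] d⁴W` with the explicit slots
`h₀ = ζ•1 + iζ•N(W₀,W₁,r₀)`, `X₁ = iζ•1 + (ζ∕2)•N + iζ•(b•V)`, `X₂ = −ζ•1 − (iζ∕4)•N + ζ•(b•V) + 2iζ•(b•(b•A₂)) + iζ•(σ•V)`, `V = A₁(W) + 2r₀•A₂` (`r₀ = |W|`, `b = 3∕(2|W|)`,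
`σ = −9∕(4|W|³)`).  §1: every slot is the `Ad`-conjugate by the frame `κ_W = rotMat W |W|` (★ `UnitBallFrameTransport`) of the SAME slot at the representative point `(|W|, 0)`:
`h₀(W) = κ·h₀(rep)·κᴴ`, `X₁(W) = κ·X₁(rep)·κᴴ`, `X₂(W) = κ·X₂(rep)·κᴴ` (all `r₀, b, σ`).  §2: hence for `Θ` invariant under `Ad κ_W` (in particular for `K`-CONJUGATION-INVARIANT `Θ`,
★ p05 `UnitBallOrbitalKAverage`) the integrand at `W` equals the integrand at `(|W|, 0)` — ★ `nestedFDeriv_two_comp_clm` with the CLM `mulLeftRight κ κᴴ` and `Θ ∘ Ad κ = Θ`; §3: along the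
ray `W = s•ω` (`nsq ω = 1`, `s > 0`) this is a function of `s` alone, and with `Ψ := Θ ∘ (ζ • ·)` the scalar `ζ` disappears: **`integrand(s•ω) = D²Ψ(M(s))[Y₁(s), Y₁(s)] + DΨ(M(s))[Y₂(s)]`**,
`M(s) = 1 + i•N(s,0,s)`, `Y₁ = i•1 + ½•N + i•(b•V)`, `Y₂ = −1 − (i∕4)•N + b•V + 2i•(b•(b•A₂)) + i•(σ•V)` at the representative — the ζ-free slots of ★ `UnitBallCentreValueInputs`
(`inputs_X1`, `inputs_X2`, `inputs_basePoint` turn them into the W4 composites).  Also the order-0 integrand: `Θ(h₀(s•ω)) = Ψ(M(s))`.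
HONEST LABEL: HC_CM is proved only modulo the printed citations until rung 0 closes; transport bookkeeping over ★ files, pays nothing by itself.

## References
* [Rogawski1990] J. D. Rogawski, *Automorphic Representations of Unitary Groups in Three Variables*, Ann. of Math. Stud. 123 (1990), §8.4 pp. 126–127.
* [Goldman1999] W. M. Goldman, *Complex Hyperbolic Geometry* (1999), §3.1.1–3.1.2 (`U(2,1)`-equivariance of `x ↦ x x* J`).
-/

noncomputable section

open Set Filter Topology Matrix Complex
open scoped Matrix.Norms.Operator ComplexConjugate

namespace Literature.Geometry.ComplexHyperbolic.BallModel

open Literature.Analysis.Calculus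

/-! ### §1 The wall-curve slots at `W` are conjugates of the slots at the representative `(r, 0)` -/

section Slots

variable (W : Fin 2 → ℂ) {r : ℝ}

/-- `Ad κ` commutes with REAL scalars: `κ (c • X) κᴴ = c • κ X κᴴ`. [cite: Goldman1999, §3.1.1] -/
theorem conj_real_smul_eq (κ : Matrix (Fin 3) (Fin 3) ℂ) (c : ℝ) (X : Matrix (Fin 3) (Fin 3) ℂ) : κ * (c • X) * κᴴ = c • (κ * X * κᴴ) := by
  rw [Matrix.mul_smul, Matrix.smul_mul]

/-- `Ad κ` commutes with negation. [cite: Goldman1999, §3.1.1] -/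
theorem conj_neg_eq (κ X : Matrix (Fin 3) (Fin 3) ℂ) : κ * (-X) * κᴴ = -(κ * X * κᴴ) := by
  rw [Matrix.mul_neg, Matrix.neg_mul]

/-- `V(W) = A₁(W) + 2r₀•A₂ = κ_W · V(r, 0) · κ_Wᴴ`. [cite: Goldman1999, §3.1.1–3.1.2] -/
theorem wallSlotV_eq_conj (hr : r ≠ 0) (r₀ : ℝ) :
    (((vecMulVec ![W 0, W 1, 0] (star ![(0 : ℂ), 0, 1]) + vecMulVec ![(0 : ℂ), 0, 1] (star ![W 0, W 1, 0])) * J) + (2 * r₀) • (vecMulVec ![(0 : ℂ), 0, 1] (star ![(0 : ℂ), 0, 1]) * J)) = rotMat W r * (((vecMulVec ![(r : ℂ), 0, 0] (star ![(0 : ℂ), 0, 1]) + vecMulVec ![(0 : ℂ), 0, 1] (star ![(r : ℂ), 0, 0])) * J) + (2 * r₀) • (vecMulVec ![(0 : ℂ), 0, 1] (star ![(0 : ℂ), 0, 1]) * J)) * (rotMat W r)ᴴ := by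
  rw [conj_add_eq, conj_real_smul_eq, ← wallSlotA₁_eq_conj W hr, ← wallSlotA₂_eq_conj W r]

/-- `b • (b • A₂) = κ_W · (b • (b • A₂)) · κ_Wᴴ`. [cite: Goldman1999, §3.1.1–3.1.2] -/
theorem wallSlotBBA₂_eq_conj (r b : ℝ) :
    b • (b • (vecMulVec ![(0 : ℂ), 0, 1] (star ![(0 : ℂ), 0, 1]) * J)) = rotMat W r * (b • (b • (vecMulVec ![(0 : ℂ), 0, 1] (star ![(0 : ℂ), 0, 1]) * J))) * (rotMat W r)ᴴ := by
  rw [conj_real_smul_eq, conj_real_smul_eq, ← wallSlotA₂_eq_conj W r]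

/-- **`h₀(W) = κ_W · h₀(r, 0) · κ_Wᴴ`** (the pencil base point, any third coordinate `r₀`). [cite: Goldman1999, §3.1.1–3.1.2] -/
theorem wallPencil_eq_conj (hr : r ≠ 0) (hW : nsq W = r ^ 2) (ζ : Circle) (r₀ : ℝ) :
    ((ζ : ℂ) • (1 : Matrix (Fin 3) (Fin 3) ℂ) + (I * (ζ : ℂ)) • (vecMulVec ![W 0, W 1, (r₀ : ℂ)] (star ![W 0, W 1, (r₀ : ℂ)]) * J)) = rotMat W r * ((ζ : ℂ) • (1 : Matrix (Fin 3) (Fin 3) ℂ) + (I * (ζ : ℂ)) • (vecMulVec ![(r : ℂ), 0, (r₀ : ℂ)] (star ![(r : ℂ), 0, (r₀ : ℂ)]) * J)) * (rotMat W r)ᴴ :=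
  pencil_vecCons_eq_conj W hr hW _ _ _

/-- **`X₁(W) = κ_W · X₁(r, 0) · κ_Wᴴ`** (p05's first slot, any `r₀`, `b`). [cite: Goldman1999, §3.1.1–3.1.2] [cite: Rogawski1990, §8.4 pp. 126–127] -/
theorem wallSlotX₁_eq_conj (hr : r ≠ 0) (hW : nsq W = r ^ 2) (ζ : Circle) (r₀ b : ℝ) :
    ((I * (ζ : ℂ)) • (1 : Matrix (Fin 3) (Fin 3) ℂ) + ((ζ : ℂ) / 2) • (vecMulVec ![W 0, W 1, (r₀ : ℂ)] (star ![W 0, W 1, (r₀ : ℂ)]) * J) + (I * (ζ : ℂ)) • (b • (((vecMulVec ![W 0, W 1, 0] (star ![(0 : ℂ), 0, 1]) + vecMulVec ![(0 : ℂ), 0, 1] (star ![W 0, W 1, 0])) * J) + (2 * r₀) • (vecMulVec ![(0 : ℂ), 0, 1] (star ![(0 : ℂ), 0, 1]) * J)))) =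
      rotMat W r * ((I * (ζ : ℂ)) • (1 : Matrix (Fin 3) (Fin 3) ℂ) + ((ζ : ℂ) / 2) • (vecMulVec ![(r : ℂ), 0, (r₀ : ℂ)] (star ![(r : ℂ), 0, (r₀ : ℂ)]) * J) + (I * (ζ : ℂ)) • (b • (((vecMulVec ![(r : ℂ), 0, 0] (star ![(0 : ℂ), 0, 1]) + vecMulVec ![(0 : ℂ), 0, 1] (star ![(r : ℂ), 0, 0])) * J) + (2 * r₀) • (vecMulVec ![(0 : ℂ), 0, 1] (star ![(0 : ℂ), 0, 1]) * J)))) * (rotMat W r)ᴴ := by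
  rw [wallSlotV_eq_conj W hr r₀, vecMulVec_vecCons_mul_J_eq_conj W hr (r₀ : ℂ)]
  conv_lhs => rw [one_eq_rotMat_conj W hr hW]
  simp only [conj_add_eq, conj_smul_eq, conj_real_smul_eq]

/-- **`X₂(W) = κ_W · X₂(r, 0) · κ_Wᴴ`** (p05's second slot, any `r₀`, `b`, `σ`). [cite: Goldman1999, §3.1.1–3.1.2] [cite: Rogawski1990, §8.4 pp. 126–127] -/
theorem wallSlotX₂_eq_conj (hr : r ≠ 0) (hW : nsq W = r ^ 2) (ζ : Circle) (r₀ b σ : ℝ) :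
    (-((ζ : ℂ) • (1 : Matrix (Fin 3) (Fin 3) ℂ)) + (-(I * (ζ : ℂ)) / 4) • (vecMulVec ![W 0, W 1, (r₀ : ℂ)] (star ![W 0, W 1, (r₀ : ℂ)]) * J) + (ζ : ℂ) • (b • (((vecMulVec ![W 0, W 1, 0] (star ![(0 : ℂ), 0, 1]) + vecMulVec ![(0 : ℂ), 0, 1] (star ![W 0, W 1, 0])) * J) + (2 * r₀) • (vecMulVec ![(0 : ℂ), 0, 1] (star ![(0 : ℂ), 0, 1]) * J))) + (2 * I * (ζ : ℂ)) • (b • (b • (vecMulVec ![(0 : ℂ), 0, 1] (star ![(0 : ℂ), 0, 1]) * J))) + (I * (ζ : ℂ)) • (σ • (((vecMulVec ![W 0, W 1, 0] (star ![(0 : ℂ), 0, 1]) + vecMulVec ![(0 : ℂ), 0, 1] (star ![W 0, W 1, 0])) * J) + (2 * r₀) • (vecMulVec ![(0 : ℂ), 0, 1] (star ![(0 : ℂ), 0, 1]) * J)))) =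
      rotMat W r * (-((ζ : ℂ) • (1 : Matrix (Fin 3) (Fin 3) ℂ)) + (-(I * (ζ : ℂ)) / 4) • (vecMulVec ![(r : ℂ), 0, (r₀ : ℂ)] (star ![(r : ℂ), 0, (r₀ : ℂ)]) * J) + (ζ : ℂ) • (b • (((vecMulVec ![(r : ℂ), 0, 0] (star ![(0 : ℂ), 0, 1]) + vecMulVec ![(0 : ℂ), 0, 1] (star ![(r : ℂ), 0, 0])) * J) + (2 * r₀) • (vecMulVec ![(0 : ℂ), 0, 1] (star ![(0 : ℂ), 0, 1]) * J))) + (2 * I * (ζ : ℂ)) • (b • (b • (vecMulVec ![(0 : ℂ), 0, 1] (star ![(0 : ℂ), 0, 1]) * J))) + (I * (ζ : ℂ)) • (σ • (((vecMulVec ![(r : ℂ), 0, 0] (star ![(0 : ℂ), 0, 1]) + vecMulVec ![(0 : ℂ), 0, 1] (star ![(r : ℂ), 0, 0])) * J) + (2 * r₀) • (vecMulVec ![(0 : ℂ), 0, 1] (star ![(0 : ℂ), 0, 1]) * J)))) * (rotMat W r)ᴴ := by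
  rw [wallSlotV_eq_conj W hr r₀, vecMulVec_vecCons_mul_J_eq_conj W hr (r₀ : ℂ)]
  conv_lhs => rw [wallSlotBBA₂_eq_conj W r b, one_eq_rotMat_conj W hr hW]
  simp only [conj_add_eq, conj_smul_eq, conj_real_smul_eq, conj_neg_eq]

end Slots

/-! ### §2 For `Θ` invariant under `Ad κ_W` the ψ-integrand at `W` is the integrand at the representative point -/

section Invariant

variable {G : Type*} [NormedAddCommGroup G] [NormedSpace ℝ G]

omit [NormedAddCommGroup G] [NormedSpace ℝ G] in
/-- Invariance under `Ad κ` as a function identity with the CLM `mulLeftRight κ κᴴ`. [cite: Goldman1999, §3.1.1] -/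
theorem comp_mulLeftRight_eq_of_invariant (Θ : Matrix (Fin 3) (Fin 3) ℂ → G) (κ : Matrix (Fin 3) (Fin 3) ℂ) (hΘκ : ∀ X, Θ (κ * X * κᴴ) = Θ X) :
    Θ ∘ (ContinuousLinearMap.mulLeftRight ℝ (Matrix (Fin 3) (Fin 3) ℂ) κ κᴴ) = Θ := by
  funext X
  simp only [Function.comp_apply, ContinuousLinearMap.mulLeftRight_apply]
  exact hΘκ X

/-- Transport of a first-order jet under an invariance: `DΘ(κMκᴴ)[κYκᴴ] = DΘ(M)[Y]`. [cite: Goldman1999, §3.1.1] -/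
theorem fderiv_conj_apply_conj_eq (Θ : Matrix (Fin 3) (Fin 3) ℂ → G) {n : WithTop ℕ∞} (hΘ : ContDiff ℝ n Θ) (hn : n ≠ 0) (κ : Matrix (Fin 3) (Fin 3) ℂ) (hΘκ : ∀ X, Θ (κ * X * κᴴ) = Θ X)
    (M Y : Matrix (Fin 3) (Fin 3) ℂ) : fderiv ℝ Θ (κ * M * κᴴ) (κ * Y * κᴴ) = fderiv ℝ Θ M Y := by
  have hcomp := comp_mulLeftRight_eq_of_invariant Θ κ hΘκ
  have h := fderiv_comp_clm_apply (ContinuousLinearMap.mulLeftRight ℝ (Matrix (Fin 3) (Fin 3) ℂ) κ κᴴ) (Θ := Θ) (x := M) ((hΘ.differentiable hn) _) Y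
  rw [hcomp] at h
  simp only [ContinuousLinearMap.mulLeftRight_apply] at h
  exact h.symm

/-- Transport of a second-order jet under an invariance: `D²Θ(κMκᴴ)[κYκᴴ][κY′κᴴ] = D²Θ(M)[Y][Y′]`. [cite: Goldman1999, §3.1.1] -/
theorem fderiv_fderiv_conj_apply_conj_eq (Θ : Matrix (Fin 3) (Fin 3) ℂ → G) (hΘ : ContDiff ℝ 2 Θ) (κ : Matrix (Fin 3) (Fin 3) ℂ) (hΘκ : ∀ X, Θ (κ * X * κᴴ) = Θ X) (M Y Y' : Matrix (Fin 3) (Fin 3) ℂ) :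
    fderiv ℝ (fderiv ℝ Θ) (κ * M * κᴴ) (κ * Y * κᴴ) (κ * Y' * κᴴ) = fderiv ℝ (fderiv ℝ Θ) M Y Y' := by
  have hcomp := comp_mulLeftRight_eq_of_invariant Θ κ hΘκ
  have h := nestedFDeriv_two_comp_clm (ContinuousLinearMap.mulLeftRight ℝ (Matrix (Fin 3) (Fin 3) ℂ) κ κᴴ) hΘ M Y Y'
  rw [hcomp] at h
  simp only [ContinuousLinearMap.mulLeftRight_apply] at h
  exact h.symm

/-- **THE ψ-INTEGRAND IS FRAME-INVARIANT**: for `Θ ∈ C²` invariant under `Ad κ_W`, `κ_W = rotMat W r`, `|W| = r ≠ 0`, p05's second-order integrand at `W` equals the same expression at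
the representative point `(r, 0)` (all `r₀, b, σ`). [cite: Rogawski1990, §8.4 pp. 126–127] [cite: Goldman1999, §3.1.1–3.1.2] -/
theorem wallCurve_integrand_two_eq_rep (Θ : Matrix (Fin 3) (Fin 3) ℂ → G) (hΘ : ContDiff ℝ 2 Θ) (W : Fin 2 → ℂ) {r : ℝ} (hr : r ≠ 0) (hW : nsq W = r ^ 2)
    (hΘκ : ∀ X, Θ (rotMat W r * X * (rotMat W r)ᴴ) = Θ X) (ζ : Circle) (r₀ b σ : ℝ) :
    fderiv ℝ (fderiv ℝ Θ) ((ζ : ℂ) • (1 : Matrix (Fin 3) (Fin 3) ℂ) + (I * (ζ : ℂ)) • (vecMulVec ![W 0, W 1, (r₀ : ℂ)] (star ![W 0, W 1, (r₀ : ℂ)]) * J)) ((I * (ζ : ℂ)) • (1 : Matrix (Fin 3) (Fin 3) ℂ) + ((ζ : ℂ) / 2) • (vecMulVec ![W 0, W 1, (r₀ : ℂ)] (star ![W 0, W 1, (r₀ : ℂ)]) * J) + (I * (ζ : ℂ)) • (b • (((vecMulVec ![W 0, W 1, 0] (star ![(0 : ℂ), 0, 1]) + vecMulVec ![(0 : ℂ),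 0, 1] (star ![W 0, W 1, 0])) * J) + (2 * r₀) • (vecMulVec ![(0 : ℂ), 0, 1] (star ![(0 : ℂ), 0, 1]) * J)))) ((I * (ζ : ℂ)) • (1 : Matrix (Fin 3) (Fin 3) ℂ) + ((ζ : ℂ) / 2) • (vecMulVec ![W 0, W 1, (r₀ : ℂ)] (star ![W 0, W 1, (r₀ : ℂ)]) * J) + (I * (ζ : ℂ)) • (b • (((vecMulVec ![W 0, W 1, 0] (star ![(0 : ℂ), 0, 1]) + vecMulVec ![(0 : ℂ), 0, 1] (star ![W 0, W 1, 0])) * J) + (2 * r₀) • (vecMulVec ![(0 : ℂ), 0, 1] (star ![(0 : ℂ), 0, 1]) * J)))) +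
        fderiv ℝ Θ ((ζ : ℂ) • (1 : Matrix (Fin 3) (Fin 3) ℂ) + (I * (ζ : ℂ)) • (vecMulVec ![W 0, W 1, (r₀ : ℂ)] (star ![W 0, W 1, (r₀ : ℂ)]) * J)) (-((ζ : ℂ) • (1 : Matrix (Fin 3) (Fin 3) ℂ)) + (-(I * (ζ : ℂ)) / 4) • (vecMulVec ![W 0, W 1, (r₀ : ℂ)] (star ![W 0, W 1, (r₀ : ℂ)]) * J) + (ζ : ℂ) • (b • (((vecMulVec ![W 0, W 1, 0] (star ![(0 : ℂ), 0, 1]) + vecMulVec ![(0 : ℂ), 0, 1] (star ![W 0, W 1, 0])) * J) + (2 * r₀) • (vecMulVec ![(0 : ℂ), 0, 1] (star ![(0 : ℂ), 0, 1]) * J))) + (2 * I * (ζ : ℂ)) • (b • (b • (vecMulVec ![(0 : ℂ), 0, 1] (star ![(0 : ℂ), 0, 1]) * J))) + (I * (ζ : ℂ)) • (σ • (((vecMulVec ![W 0, W 1, 0] (star ![(0 : ℂ), 0, 1]) + vecMulVec ![(0 : ℂ), 0, 1] (star ![W 0, W 1, 0])) * J) + (2 * r₀) • (vecMulVec ![(0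 : ℂ), 0, 1] (star ![(0 : ℂ), 0, 1]) * J)))) =
      fderiv ℝ (fderiv ℝ Θ) ((ζ : ℂ) • (1 : Matrix (Fin 3) (Fin 3) ℂ) + (I * (ζ : ℂ)) • (vecMulVec ![(r : ℂ), 0, (r₀ : ℂ)] (star ![(r : ℂ), 0, (r₀ : ℂ)]) * J)) ((I * (ζ : ℂ)) • (1 : Matrix (Fin 3) (Fin 3) ℂ) + ((ζ : ℂ) / 2) • (vecMulVec ![(r : ℂ), 0, (r₀ : ℂ)] (star ![(r : ℂ), 0, (r₀ : ℂ)]) * J) + (I * (ζ : ℂ)) • (b • (((vecMulVec ![(r : ℂ), 0, 0] (star ![(0 : ℂ), 0, 1]) + vecMulVec ![(0 : ℂ), 0, 1] (star ![(r : ℂ), 0, 0])) * J) + (2 * r₀) • (vecMulVec ![(0 : ℂ), 0, 1] (star ![(0 : ℂ), 0, 1]) * J)))) ((I * (ζ : ℂ)) • (1 : Matrix (Fin 3) (Fin 3) ℂ) + ((ζ : ℂ) / 2) • (vecMulVec ![(r : ℂ), 0, (r₀ : ℂ)] (star ![(r : ℂ), 0, (r₀ : ℂ)]) * J) + (I * (ζ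 : ℂ)) • (b • (((vecMulVec ![(r : ℂ), 0, 0] (star ![(0 : ℂ), 0, 1]) + vecMulVec ![(0 : ℂ), 0, 1] (star ![(r : ℂ), 0, 0])) * J) + (2 * r₀) • (vecMulVec ![(0 : ℂ), 0, 1] (star ![(0 : ℂ), 0, 1]) * J)))) +
        fderiv ℝ Θ ((ζ : ℂ) • (1 : Matrix (Fin 3) (Fin 3) ℂ) + (I * (ζ : ℂ)) • (vecMulVec ![(r : ℂ), 0, (r₀ : ℂ)] (star ![(r : ℂ), 0, (r₀ : ℂ)]) * J)) (-((ζ : ℂ) • (1 : Matrix (Fin 3) (Fin 3) ℂ)) + (-(I * (ζ : ℂ)) / 4) • (vecMulVec ![(r : ℂ), 0, (r₀ : ℂ)] (star ![(r : ℂ), 0, (r₀ : ℂ)]) * J) + (ζ : ℂ) • (b • (((vecMulVec ![(r : ℂ), 0, 0] (star ![(0 : ℂ), 0, 1]) + vecMulVec ![(0 : ℂ), 0, 1] (star ![(r : ℂ), 0, 0])) * J) + (2 * r₀) • (vecMulVec ![(0 : ℂ), 0, 1] (star ![(0 : ℂ), 0, 1]) * J))) + (2 * I * (ζ : ℂ))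 • (b • (b • (vecMulVec ![(0 : ℂ), 0, 1] (star ![(0 : ℂ), 0, 1]) * J))) + (I * (ζ : ℂ)) • (σ • (((vecMulVec ![(r : ℂ), 0, 0] (star ![(0 : ℂ), 0, 1]) + vecMulVec ![(0 : ℂ), 0, 1] (star ![(r : ℂ), 0, 0])) * J) + (2 * r₀) • (vecMulVec ![(0 : ℂ), 0, 1] (star ![(0 : ℂ), 0, 1]) * J)))) := by
  rw [wallPencil_eq_conj W hr hW ζ r₀, wallSlotX₁_eq_conj W hr hW ζ r₀ b, wallSlotX₂_eq_conj W hr hW ζ r₀ b σ,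
    fderiv_fderiv_conj_apply_conj_eq Θ hΘ _ hΘκ, fderiv_conj_apply_conj_eq Θ hΘ two_ne_zero _ hΘκ]

omit [NormedAddCommGroup G] [NormedSpace ℝ G] in
/-- … and the order-zero integrand: `Θ(h₀(W)) = Θ(h₀(r, 0))`. [cite: Goldman1999, §3.1.1–3.1.2] -/
theorem wallCurve_integrand_zero_eq_rep (Θ : Matrix (Fin 3) (Fin 3) ℂ → G) (W : Fin 2 → ℂ) {r : ℝ} (hr : r ≠ 0) (hW : nsq W = r ^ 2)
    (hΘκ : ∀ X, Θ (rotMat W r * X * (rotMat W r)ᴴ) = Θ X) (ζ : Circle) (r₀ : ℝ) :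
    Θ ((ζ : ℂ) • (1 : Matrix (Fin 3) (Fin 3) ℂ) + (I * (ζ : ℂ)) • (vecMulVec ![W 0, W 1, (r₀ : ℂ)] (star ![W 0, W 1, (r₀ : ℂ)]) * J)) = Θ ((ζ : ℂ) • (1 : Matrix (Fin 3) (Fin 3) ℂ) + (I * (ζ : ℂ)) • (vecMulVec ![(r : ℂ), 0, (r₀ : ℂ)] (star ![(r : ℂ), 0, (r₀ : ℂ)]) * J)) := by
  rw [wallPencil_eq_conj W hr hW ζ r₀, hΘκ]

end Invariant

/-! ### §3 Along a ray, with the scalar `ζ` stripped: `Ψ = Θ ∘ (ζ • ·)` -/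

section Ray

variable {G : Type*} [NormedAddCommGroup G] [NormedSpace ℝ G]

/-- The representative base point is `ζ • (1 + i•N(r,0,r₀))`. [cite: Rogawski1990, §8.4 pp. 126–127] -/
theorem repPencil_eq_smul (ζ : Circle) (r r₀ : ℝ) :
    ((ζ : ℂ) • (1 : Matrix (Fin 3) (Fin 3) ℂ) + (I * (ζ : ℂ)) • (vecMulVec ![(r : ℂ), 0, (r₀ : ℂ)] (star ![(r : ℂ), 0, (r₀ : ℂ)]) * J)) = (ζ : ℂ) • ((1 : Matrix (Fin 3) (Fin 3) ℂ) + I • (vecMulVec ![(r : ℂ), 0, (r₀ : ℂ)] (star ![(r : ℂ), 0, (r₀ : ℂ)]) * J)) := by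
  rw [smul_add, smul_smul, mul_comm (ζ : ℂ) I]

/-- `X₁(rep) = ζ • Y₁`. [cite: Rogawski1990, §8.4 pp. 126–127] -/
theorem repSlotX₁_eq_smul (ζ : Circle) (r r₀ b : ℝ) :
    ((I * (ζ : ℂ)) • (1 : Matrix (Fin 3) (Fin 3) ℂ) + ((ζ : ℂ) / 2) • (vecMulVec ![(r : ℂ), 0, (r₀ : ℂ)] (star ![(r : ℂ), 0, (r₀ : ℂ)]) * J) + (I * (ζ : ℂ)) • (b • (((vecMulVec ![(r : ℂ), 0, 0] (star ![(0 : ℂ), 0, 1]) + vecMulVec ![(0 : ℂ), 0, 1] (star ![(r : ℂ), 0, 0])) * J) + (2 * r₀) • (vecMulVec ![(0 : ℂ), 0, 1] (star ![(0 : ℂ), 0, 1]) * J)))) = (ζ : ℂ) • (I • (1 : Matrix (Fin 3) (Fin 3) ℂ) + ((1 : ℂ) / 2) • (vecMulVec ![(r : ℂ), 0, (r₀ : ℂ)] (star ![(r : ℂ), 0, (r₀ : ℂ)]) * J) + I • (b • (((vecMulVec ![(r : ℂ), 0, 0] (star ![(0 : ℂ), 0, 1]) + vecMulVec ![(0 :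 ℂ), 0, 1] (star ![(r : ℂ), 0, 0])) * J) + (2 * r₀) • (vecMulVec ![(0 : ℂ), 0, 1] (star ![(0 : ℂ), 0, 1]) * J)))) := by
  ext i j
  fin_cases i <;> fin_cases j <;>
    simp [Matrix.add_apply, Matrix.smul_apply, Matrix.mul_apply, J, Matrix.diagonal_apply] <;>
    ring

/-- `X₂(rep) = ζ • Y₂`. [cite: Rogawski1990, §8.4 pp. 126–127] -/
theorem repSlotX₂_eq_smul (ζ : Circle) (r r₀ b σ : ℝ) :
    (-((ζ : ℂ) • (1 : Matrix (Fin 3) (Fin 3) ℂ)) + (-(I * (ζ : ℂ)) / 4) • (vecMulVec ![(r : ℂ), 0, (r₀ : ℂ)] (star ![(r : ℂ), 0, (r₀ : ℂ)]) * J) + (ζ : ℂ) • (b • (((vecMulVec ![(r : ℂ), 0, 0] (star ![(0 : ℂ), 0, 1]) + vecMulVec ![(0 : ℂ), 0, 1] (star ![(r : ℂ), 0, 0])) * J) + (2 * r₀) • (vecMulVec ![(0 : ℂ), 0, 1] (star ![(0 : ℂ), 0, 1]) * J))) + (2 * I * (ζ : ℂ)) • (b • (b • (vecMulVec ![(0 :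 ℂ), 0, 1] (star ![(0 : ℂ), 0, 1]) * J))) + (I * (ζ : ℂ)) • (σ • (((vecMulVec ![(r : ℂ), 0, 0] (star ![(0 : ℂ), 0, 1]) + vecMulVec ![(0 : ℂ), 0, 1] (star ![(r : ℂ), 0, 0])) * J) + (2 * r₀) • (vecMulVec ![(0 : ℂ), 0, 1] (star ![(0 : ℂ), 0, 1]) * J)))) = (ζ : ℂ) • (-(1 : Matrix (Fin 3) (Fin 3) ℂ) + (-I / 4) • (vecMulVec ![(r : ℂ), 0, (r₀ : ℂ)] (star ![(r : ℂ), 0, (r₀ : ℂ)]) * J) + b • (((vecMulVec ![(r : ℂ), 0, 0] (star ![(0 : ℂ), 0, 1]) + vecMulVec ![(0 : ℂ), 0, 1] (star ![(r : ℂ), 0, 0])) * J) + (2 * r₀) • (vecMulVec ![(0 : ℂ), 0, 1] (star ![(0 : ℂ), 0, 1]) * J)) + (2 * I) • (b • (b • (vecMulVec ![(0 : ℂ), 0, 1] (star ![(0 : ℂ), 0, 1]) * J))) + I • (σ • (((vecMulVec ![(r : ℂ), 0, 0] (star ![(0 : ℂ), 0, 1]) + vecMulVec ![(0 : ℂ),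 0, 1] (star ![(r : ℂ), 0, 0])) * J) + (2 * r₀) • (vecMulVec ![(0 : ℂ), 0, 1] (star ![(0 : ℂ), 0, 1]) * J)))) := by
  ext i j
  fin_cases i <;> fin_cases j <;>
    simp [Matrix.add_apply, Matrix.smul_apply, Matrix.mul_apply, J, Matrix.diagonal_apply] <;>
    ring

/-- Stripping `ζ`: `DΘ(ζ•M)[ζ•Y] = DΨ(M)[Y]` and `D²Θ(ζ•M)[ζ•Y][ζ•Y′] = D²Ψ(M)[Y][Y′]` for `Ψ = Θ ∘ (ζ • ·)` (★ transport with the CLM `ζ • id`). [cite: Rogawski1990, §8.4 pp. 126–127] -/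
theorem fderiv_fderiv_smul_eq_comp (Θ : Matrix (Fin 3) (Fin 3) ℂ → G) (hΘ : ContDiff ℝ 2 Θ) (c : ℂ) (M Y Y' : Matrix (Fin 3) (Fin 3) ℂ) :
    fderiv ℝ (fderiv ℝ Θ) (c • M) (c • Y) (c • Y') = fderiv ℝ (fderiv ℝ (fun X : Matrix (Fin 3) (Fin 3) ℂ => Θ (c • X))) M Y Y' ∧
      fderiv ℝ Θ (c • M) (c • Y) = fderiv ℝ (fun X : Matrix (Fin 3) (Fin 3) ℂ => Θ (c • X)) M Y := by
  have hA : Θ ∘ (ContinuousLinearMap.mulLeftRight ℝ (Matrix (Fin 3) (Fin 3) ℂ) (c • (1 : Matrix (Fin 3) (Fin 3) ℂ)) 1) = fun X : Matrix (Fin 3) (Fin 3) ℂ => Θ (c • X) := by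
    funext X; simp [ContinuousLinearMap.mulLeftRight_apply]
  refine ⟨?_, ?_⟩
  · have h := nestedFDeriv_two_comp_clm (ContinuousLinearMap.mulLeftRight ℝ (Matrix (Fin 3) (Fin 3) ℂ) (c • (1 : Matrix (Fin 3) (Fin 3) ℂ)) 1) hΘ M Y Y'
    rw [hA] at h
    simp only [ContinuousLinearMap.mulLeftRight_apply, smul_one_mul, Matrix.mul_one] at h
    exact h.symm
  · have h := fderiv_comp_clm_apply (ContinuousLinearMap.mulLeftRight ℝ (Matrix (Fin 3) (Fin 3) ℂ) (c • (1 : Matrix (Fin 3) (Fin 3) ℂ)) 1) (Θ := Θ) (x := M) ((hΘ.differentiable two_ne_zero) _) Y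
    rw [hA] at h
    simp only [ContinuousLinearMap.mulLeftRight_apply, smul_one_mul, Matrix.mul_one] at h
    exact h.symm

/-- **THE ψ-INTEGRAND ALONG A RAY, `ζ` STRIPPED**: for `Θ ∈ C²` invariant under `Ad (rotMat (s•ω) s)` (`nsq ω = 1`, `s > 0`; e.g. `K`-conjugation-invariant `Θ`), p05's second-order
integrand at `W = s•ω` (with `r₀ = |W|`, `b = 3∕(2|W|)`, `σ = −9∕(4|W|³)` as printed in ★ `iteratedDerivWithin_two_wallCurve_sheetIntegral_zero_eq`) equals
`D²Ψ(M(s))[Y₁(s), Y₁(s)] + DΨ(M(s))[Y₂(s)]` with `Ψ = Θ ∘ (ζ • ·)` and the ζ-free representative slots. [cite: Rogawski1990, §8.4 pp. 126–127] [cite: Goldman1999, §3.1.1–3.1.2] -/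
theorem wallCurve_integrand_two_ray_eq (Θ : Matrix (Fin 3) (Fin 3) ℂ → G) (hΘ : ContDiff ℝ 2 Θ) (ζ : Circle) {ω : Fin 2 → ℂ} (hω : nsq ω = 1) {s : ℝ} (hs : 0 < s)
    (hΘκ : ∀ X, Θ (rotMat (s • ω) s * X * (rotMat (s • ω) s)ᴴ) = Θ X) :
    fderiv ℝ (fderiv ℝ Θ) ((ζ : ℂ) • (1 : Matrix (Fin 3) (Fin 3) ℂ) + (I * (ζ : ℂ)) • (vecMulVec ![(s • ω) 0, (s • ω) 1, (Real.sqrt (nsq (s • ω)) : ℂ)] (star ![(s • ω) 0, (s • ω) 1, (Real.sqrt (nsq (s • ω)) : ℂ)]) * J)) ((I * (ζ : ℂ)) • (1 : Matrix (Fin 3) (Fin 3) ℂ) + ((ζ : ℂ) / 2) • (vecMulVec ![(s • ω) 0, (s • ω) 1, (Real.sqrt (nsq (s • ω)) : ℂ)] (star ![(s • ω) 0, (s • ω) 1, (Real.sqrt (nsq (s • ω)) : ℂ)]) * J) + (I * (ζ : ℂ)) • ((3 * (2 * Real.sqrt (nsq (s • ω)))⁻¹) • (((vecMulVec ![(s •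 ω) 0, (s • ω) 1, 0] (star ![(0 : ℂ), 0, 1]) + vecMulVec ![(0 : ℂ), 0, 1] (star ![(s • ω) 0, (s • ω) 1, 0])) * J) + (2 * Real.sqrt (nsq (s • ω))) • (vecMulVec ![(0 : ℂ), 0, 1] (star ![(0 : ℂ), 0, 1]) * J)))) ((I * (ζ : ℂ)) • (1 : Matrix (Fin 3) (Fin 3) ℂ) + ((ζ : ℂ) / 2) • (vecMulVec ![(s • ω) 0, (s • ω) 1, (Real.sqrt (nsq (s • ω)) : ℂ)] (star ![(s • ω) 0, (s • ω) 1, (Real.sqrt (nsq (s • ω)) : ℂ)]) * J) + (I * (ζ : ℂ)) • ((3 * (2 * Real.sqrt (nsq (s • ω)))⁻¹) • (((vecMulVec ![(s • ω) 0, (s • ω) 1, 0] (star ![(0 : ℂ), 0, 1]) + vecMulVec ![(0 : ℂ), 0, 1] (star ![(s • ω) 0, (s • ω) 1, 0])) * J) + (2 * Real.sqrt (nsq (s • ω))) • (vecMulVec ![(0 : ℂ), 0, 1] (star ![(0 : ℂ), 0, 1]) * J)))) +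
        fderiv ℝ Θ ((ζ : ℂ) • (1 : Matrix (Fin 3) (Fin 3) ℂ) + (I * (ζ : ℂ)) • (vecMulVec ![(s • ω) 0, (s • ω) 1, (Real.sqrt (nsq (s • ω)) : ℂ)] (star ![(s • ω) 0, (s • ω) 1, (Real.sqrt (nsq (s • ω)) : ℂ)]) * J)) (-((ζ : ℂ) • (1 : Matrix (Fin 3) (Fin 3) ℂ)) + (-(I * (ζ : ℂ)) / 4) • (vecMulVec ![(s • ω) 0, (s • ω) 1, (Real.sqrt (nsq (s • ω)) : ℂ)] (star ![(s • ω) 0, (s • ω) 1, (Real.sqrt (nsq (s • ω)) : ℂ)]) * J) + (ζ : ℂ) • ((3 * (2 * Real.sqrt (nsq (s • ω)))⁻¹) • (((vecMulVec ![(s • ω) 0, (s • ω) 1, 0] (star ![(0 : ℂ), 0, 1]) + vecMulVec ![(0 : ℂ), 0, 1] (star ![(s • ω) 0, (s • ω) 1, 0])) * J) + (2 * Real.sqrt (nsq (s • ω))) • (vecMulVec ![(0 : ℂ), 0, 1] (star ![(0 : ℂ), 0, 1]) * J))) + (2 * I * (ζ : ℂ)) • ((3 * (2 * Real.sqrt (nsq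 (s • ω)))⁻¹) • ((3 * (2 * Real.sqrt (nsq (s • ω)))⁻¹) • (vecMulVec ![(0 : ℂ), 0, 1] (star ![(0 : ℂ), 0, 1]) * J))) + (I * (ζ : ℂ)) • ((-(9 * (4 * Real.sqrt (nsq (s • ω)) ^ 3)⁻¹)) • (((vecMulVec ![(s • ω) 0, (s • ω) 1, 0] (star ![(0 : ℂ), 0, 1]) + vecMulVec ![(0 : ℂ), 0, 1] (star ![(s • ω) 0, (s • ω) 1, 0])) * J) + (2 * Real.sqrt (nsq (s • ω))) • (vecMulVec ![(0 : ℂ), 0, 1] (star ![(0 : ℂ), 0, 1]) * J)))) =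
      fderiv ℝ (fderiv ℝ (fun X : Matrix (Fin 3) (Fin 3) ℂ => Θ ((ζ : ℂ) • X))) ((1 : Matrix (Fin 3) (Fin 3) ℂ) + I • (vecMulVec ![(s : ℂ), 0, (s : ℂ)] (star ![(s : ℂ), 0, (s : ℂ)]) * J)) (I • (1 : Matrix (Fin 3) (Fin 3) ℂ) + ((1 : ℂ) / 2) • (vecMulVec ![(s : ℂ), 0, (s : ℂ)] (star ![(s : ℂ), 0, (s : ℂ)]) * J) + I • ((3 * (2 * s)⁻¹) • (((vecMulVec ![(s : ℂ), 0, 0] (star ![(0 : ℂ), 0, 1]) + vecMulVec ![(0 : ℂ), 0, 1] (star ![(s : ℂ), 0, 0])) * J) + (2 * s) • (vecMulVec ![(0 : ℂ), 0, 1] (star ![(0 : ℂ), 0, 1]) * J)))) (I • (1 : Matrix (Fin 3) (Fin 3) ℂ) + ((1 : ℂ) / 2) • (vecMulVec ![(s : ℂ), 0, (s : ℂ)] (star ![(s : ℂ), 0, (s : ℂ)]) * J) + I • ((3 * (2 * s)⁻¹) • (((vecMulVec ![(s : ℂ), 0, 0] (star ![(0 : ℂ), 0, 1]) + vecMulVec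 ![(0 : ℂ), 0, 1] (star ![(s : ℂ), 0, 0])) * J) + (2 * s) • (vecMulVec ![(0 : ℂ), 0, 1] (star ![(0 : ℂ), 0, 1]) * J)))) +
        fderiv ℝ (fun X : Matrix (Fin 3) (Fin 3) ℂ => Θ ((ζ : ℂ) • X)) ((1 : Matrix (Fin 3) (Fin 3) ℂ) + I • (vecMulVec ![(s : ℂ), 0, (s : ℂ)] (star ![(s : ℂ), 0, (s : ℂ)]) * J)) (-(1 : Matrix (Fin 3) (Fin 3) ℂ) + (-I / 4) • (vecMulVec ![(s : ℂ), 0, (s : ℂ)] (star ![(s : ℂ), 0, (s : ℂ)]) * J) + (3 * (2 * s)⁻¹) • (((vecMulVec ![(s : ℂ), 0, 0] (star ![(0 : ℂ), 0, 1]) + vecMulVec ![(0 : ℂ), 0, 1] (star ![(s : ℂ), 0, 0])) * J) + (2 * s) • (vecMulVec ![(0 : ℂ), 0, 1] (star ![(0 : ℂ), 0, 1]) * J)) + (2 * I) • ((3 * (2 * s)⁻¹) • ((3 * (2 * s)⁻¹) • (vecMulVec ![(0 : ℂ), 0, 1] (star ![(0 : ℂ), 0, 1]) * J))) + I • ((-(9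 * (4 * s ^ 3)⁻¹)) • (((vecMulVec ![(s : ℂ), 0, 0] (star ![(0 : ℂ), 0, 1]) + vecMulVec ![(0 : ℂ), 0, 1] (star ![(s : ℂ), 0, 0])) * J) + (2 * s) • (vecMulVec ![(0 : ℂ), 0, 1] (star ![(0 : ℂ), 0, 1]) * J)))) := by
  have hsq : Real.sqrt (nsq (s • ω)) = s := by
    rw [nsq_real_smul, hω, mul_one, Real.sqrt_sq hs.le]
  have hW : nsq (s • ω) = s ^ 2 := by rw [nsq_real_smul, hω, mul_one]
  rw [hsq, wallCurve_integrand_two_eq_rep Θ hΘ (s • ω) hs.ne' hW hΘκ ζ s (3 * (2 * s)⁻¹) (-(9 * (4 * s ^ 3)⁻¹)), repPencil_eq_smul, repSlotX₁_eq_smul,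
    repSlotX₂_eq_smul, (fderiv_fderiv_smul_eq_comp Θ hΘ (ζ : ℂ) _ _ _).1, (fderiv_fderiv_smul_eq_comp Θ hΘ (ζ : ℂ) _ _ 0).2]

omit [NormedAddCommGroup G] [NormedSpace ℝ G] in
/-- **THE ORDER-ZERO ψ-INTEGRAND ALONG A RAY**: `Θ(h₀(s•ω)) = Ψ(1 + i•N(s,0,s))`, `Ψ = Θ ∘ (ζ • ·)`. [cite: Rogawski1990, §8.4 pp. 126–127] -/
theorem wallCurve_integrand_zero_ray_eq (Θ : Matrix (Fin 3) (Fin 3) ℂ → G) (ζ : Circle) {ω : Fin 2 → ℂ} (hω : nsq ω = 1) {s : ℝ} (hs : 0 < s)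
    (hΘκ : ∀ X, Θ (rotMat (s • ω) s * X * (rotMat (s • ω) s)ᴴ) = Θ X) :
    Θ ((ζ : ℂ) • (1 : Matrix (Fin 3) (Fin 3) ℂ) + (I * (ζ : ℂ)) • (vecMulVec ![(s • ω) 0, (s • ω) 1, (Real.sqrt (nsq (s • ω)) : ℂ)] (star ![(s • ω) 0, (s • ω) 1, (Real.sqrt (nsq (s • ω)) : ℂ)]) * J)) = (fun X : Matrix (Fin 3) (Fin 3) ℂ => Θ ((ζ : ℂ) • X)) ((1 : Matrix (Fin 3) (Fin 3) ℂ) + I • (vecMulVec ![(s : ℂ), 0, (s : ℂ)] (star ![(s : ℂ), 0, (s : ℂ)]) * J)) := by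
  have hsq : Real.sqrt (nsq (s • ω)) = s := by
    rw [nsq_real_smul, hω, mul_one, Real.sqrt_sq hs.le]
  have hW : nsq (s • ω) = s ^ 2 := by rw [nsq_real_smul, hω, mul_one]
  rw [hsq, wallCurve_integrand_zero_eq_rep Θ (s • ω) hs.ne' hW hΘκ ζ s, repPencil_eq_smul]

omit [NormedAddCommGroup G] [NormedSpace ℝ G] in
/-- **`K`-INVARIANCE SUPPLIES THE HYPOTHESIS**: a test function invariant under every unitary `κ` commuting with `J` (`K = U(2) × U(1)`-conjugation invariance, matrix form) is invariant
under `Ad (rotMat (s•ω) s)`. [cite: Goldman1999, §3.1.1–3.1.2] -/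
theorem invariant_rotMat_of_kInvariant (Θ : Matrix (Fin 3) (Fin 3) ℂ → G)
    (hK : ∀ κ : Matrix (Fin 3) (Fin 3) ℂ, κ * κᴴ = 1 → κ * J = J * κ → ∀ X, Θ (κ * X * κᴴ) = Θ X) {ω : Fin 2 → ℂ} (hω : nsq ω = 1) {s : ℝ} (hs : 0 < s) (X : Matrix (Fin 3) (Fin 3) ℂ) :
    Θ (rotMat (s • ω) s * X * (rotMat (s • ω) s)ᴴ) = Θ X := by
  have hW : nsq (s • ω) = s ^ 2 := by rw [nsq_real_smul, hω, mul_one]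
  exact hK _ (rotMat_mul_conjTranspose_self (s • ω) hs.ne' hW) (rotMat_mul_J (s • ω) s) X

end Ray

end Literature.Geometry.ComplexHyperbolic.BallModel

end
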